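import Summits.QuantumFields.BalabanUV.Beta.D1BFx.FrozenAveragingWard
import Summits.QuantumFields.BalabanUV.Beta.D1BFx.BlockGaugeEnvelope
import Summits.QuantumFields.BalabanUV.Beta.D1BFx.PackedDJetsGradient
import Summits.QuantumFields.BalabanUV.Beta.D1BFx.GhostBracketGaugeSplit

/-!
# `BalabanUV.Beta.D1BFx.GhostLoopGaugeVariation` — road «BF-x» for binder row D1, slot (K), junction (J3), ROUTE M of TB5-1′ ((C3) by the Ward route),
# FILE C2: **THE GAUGE VARIATION OF THE `D*D`-ONLY GHOST WORD IS A `Q′*Q′`-WORD, AND THE FOUR `Q′`-WORDS AT THE ROAD's DRESSED WEIGHTS ARE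
# THE UNDRESSED ONES PLUS IT**: with `DD[w] := hessKer (Ggh n a) 𝒱_D[w] 𝒲_D[w,w]` (stencil `n²•ghCur`, table `diagExt ((−n²)•ghX)`, packed with the
# weight family `w`), `χ_{μ,y} := bmGaugeAt (toSite r) (colH K₀ n μ y) n` and `P_a := a·n⁻⁴·1[same block]`,
# `DD[colH K₀] μ ν z − DD[colH G₀] μ ν z = ½·bubble Ggh [P_a, χ̂_{μ,0}] 𝒱_D[colH K₀]_{ν,z} + ½·bubble Ggh 𝒱_D[colH G₀]_{μ,0} [P_a, χ̂_{ν,z}]`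
# `= ½·bubble Ggh [P_a, χ̂_{μ,0}] 𝒱_D[colH K₀]_{ν,z} + ½·bubble Ggh 𝒱_D[colH K₀]_{μ,0} [P_a, χ̂_{ν,z}] − ½·tadpole Ggh [[P_a, χ̂_{ν,z}], χ̂_{μ,0}] + ½·bubble Ggh [P_a, χ̂_{μ,0}] [P_a, χ̂_{ν,z}]`,
# (FILE C3 `GhostBracketGaugeSplit`: `BR[colH G₀] = BR[colH K₀] + (DD[colH K₀] − DD[colH G₀])`, `BR[colH K₀] = PghQ(…, a) − PghQ(…, 0)`).

WHY (journal [D1LEAF04-G22-ONLINE], gan24-leaf-05 g55 W-2, an2 g42 W-7): the STRUCTURE of record for the four `Q′`-words `BR` of the OWNER's «RJ3 FORMULA»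
(`GhostDeficitFormula`): at the road's dressed weights they are g18's ΔGH words (`BR[colH K₀] = PghQ n a (−1) n² a − PghQ n a (−1) n² 0 = −½·ΔGH`, a
(1.22)-vanishing row, `RestKernelGhostDelta`) plus the gauge variation of the frozen-averaging ghost loop, which by FILE B's Ward identity sees ONLY the frozen
averaging `P_a` (two resp. four χ-words, every one with a `[P_a, χ̂]` factor).  The rows themselves ((C3) `hMRB ∕ hCB`) are gan24-leaf-05's by the direct count.

CONTENT (all [folklore]; `n ≥ 1`; commutators POINTWISE as in FILE B: `[K, f̂] = (x z ↦ (f z − f x)·K x z)`):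
* §1 (FILE C1 `PackedDJetsGradient`, imported): the packed `D*D` jets at a GRADIENT weight are commutators; here `loc_commK`.
* §2 the instance (`n = m+1`, `r ∈ box 4 n`, `0 < a`): `colH_K₀_eq_G₀_add_grad`, `packD_stencil_K₀_eq`, `packD_table_K₀_eq`, Loc letters, and the two displayed
  identities **`DD_K₀_sub_DD_G₀_eq_two`**, **`DD_K₀_sub_DD_G₀_eq_four`**.

HONEST DEPENDENCY (cell records, verbatim): «continuum YM on T⁴ ⇐ BetaPertH ∧ nine spine estimates (0/9 proved); BetaPertH ⇐ (D1) ∧ (D4) ∧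
CAP+tail; G-an2-4 gates asym, D1 and NE2/3/4.»  HONEST FRAMING (cell contract, verbatim): «discharging `BetaPertH` makes Bałaban's UV stability
UNCONDITIONAL — a real constructive-QFT result; it is NOT the continuum limit and NOT the Clay problem.»  THIS MODULE DISCHARGES NOTHING of (K),
of D1 or of the wall: [folklore] summation by parts + FILE B's trace algebra over OUR packed objects; no estimate, no row; nothing of Bałaban's asserted.
No definition, no `def … : Prop`, nothing cited, 0 sorry.  0 root-level binders of row D1 discharged; (J3) DISPLAYED; (K) NOT closed; NOT D1, NOT
`BetaPertH`, NOT continuum, NOT Clay.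
ABSOLUTE RULE (cell charter, verbatim): «No internally-minted statement may enter as a cited fact. Every hypothesis is either kernel-proved in this
package or a verbatim quotation of a PUBLISHED theorem with page reference. The manuscript(s) under audit are NOT citable for their own disputed
steps — they are the thing under adjudication; programme-internal (2001/route/tribunal) claims are never citable.»
Unit `b2b-balaban-beta-d1-formalise-leaf-04` (gen 22), D1 formalisation swarm leaf prover 04, road «BF-x»; ROUTE M (C3) structure, FILE C2 (journal [D1LEAF04-G22-*]).
-/

noncomputable section

namespace Summit.QuantumFields.BalabanUV.Beta.D1BFx.GhostLoopGaugeVariation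

open Finset
open scoped BigOperators
open Literature.MathematicalPhysics.QuantumFieldTheory.Balaban1983to89
open Literature.MathematicalPhysics.QuantumFieldTheory.Balaban1983to89.Beta
open B12Sec2to5 (l1 l1_nonneg)
open B5Hk163Strip (kappa163 kappa163_pos)
open B5Hk163Decay (MG163)
open B4TorusKernel (periodConst)
open B6QGQLower276 (blk lapKer sameBlk)
open ExpKernelCalculus (Site MKer BiLoc hessKer bubble tadpole)
open AffineAveraging (box toSite unitVec)
open OneStepKernelFamily (KInvStep colH)
open OneStepResolventKernel (wsum)
open Summit.QuantumFields.BalabanUV.Beta.TameKernelCalculus (Spr Loc Loc.sub Loc.add tadpole_add bubble_add_left bubble_add_right)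
open Summit.QuantumFields.BalabanUV.Beta.KernelWardRelative (loc_finset_sum)
open Summit.QuantumFields.BalabanUV.Beta.AxialDressingRooted (coDressKBmAt)
open Summit.QuantumFields.BalabanUV.Beta.AxialProjectorBlockMean (bmGaugeAt)
open Summit.QuantumFields.BalabanUV.Beta.GAN24.CoDressedColumnPairing (colH_coDressKBmAt_eq_sub_grad sum_tsum_grad_mul_eq_neg_tsum_mul_div)
open Summit.QuantumFields.BalabanUV.Beta.D1BFx.GhostLeg (Ggh spr_Ggh)
open Summit.QuantumFields.BalabanUV.Beta.D1BFx.GhostStencil (ghCur ghCur_apply biLoc_ghCur)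
open Summit.QuantumFields.BalabanUV.Beta.D1BFx.GhostStencilReflection (ghX ghX_apply biLoc_ghX)
open Summit.QuantumFields.BalabanUV.Beta.D1BFx.GhostStencilRooted (SghAt qAntiAt)
open Summit.QuantumFields.BalabanUV.Beta.D1BFx.GhostStencilRootedReflection (ctrHalf ctrHalf_mem)
open Summit.QuantumFields.BalabanUV.Beta.D1BFx.GhostAveragingSquare (WghAt qSqAt)
open Summit.QuantumFields.BalabanUV.Beta.D1BFx.GhostStencilDivergence (Oker Oker_apply)
open Summit.QuantumFields.BalabanUV.Beta.D1BFx.GhostLegWard (summable_ite_point)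
open Summit.QuantumFields.BalabanUV.Beta.D1BFx.ReducedKernelSandwichBlock (diagExt biLoc_diagExt)
open Summit.QuantumFields.BalabanUV.Beta.D1BFx.GhostKernel (biLoc_smul')
open Summit.QuantumFields.BalabanUV.Beta.D1BFx.GhostKernelComplete (PghQ)
open Summit.QuantumFields.BalabanUV.Beta.D1BFx.PackedWordPairing (loc_packed_stencil loc_packed_table)
open Summit.QuantumFields.BalabanUV.Beta.D1BFx.PackedWordSplit (ghost_word_split)
open Summit.QuantumFields.BalabanUV.Beta.D1BFx.GhostWardWord (ghost_word_dressed_eq_undressed abs_colH_K₀_road_le_l1 colH_K₀_road_weight_nonneg road_rate_pos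
  hessKer_K₀_packed_eq_TOfGh)
open Summit.QuantumFields.BalabanUV.Beta.D1BFx.PackedColumnEnvelope (abs_colH_G₀_road_le colH_G₀_road_weight_nonneg)
open Summit.QuantumFields.BalabanUV.Beta.D1BFx.GhostDeficitFormula (sum_sum_wsum_diagExt)
open Summit.QuantumFields.BalabanUV.Beta.D1BFx.BlockGaugeEnvelope (abs_bmGauge_colH_K₀_le')
open Summit.QuantumFields.BalabanUV.Beta.D1BFx.FrozenAveragingWard (env_const_nonneg abs_le_env_const loc_commK_lap loc_commK_blk loc_commK_Oker bubble_symm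
  bubble_sub_left bubble_Ggh_comm_Oker hess_slot_grad hess_grad_slot)

open Summit.QuantumFields.BalabanUV.Beta.D1BFx.GhostBracketGaugeSplit (BR_G₀_eq_BR_K₀_add BR_K₀_eq_PghQ_sub)
open Summit.QuantumFields.BalabanUV.Beta.D1BFx.PackedDJetsGradient (packD_stencil_grad packD_table_grad_right packD_table_grad_left packD_stencil_add
  packD_table_add_left packD_table_add_right)

/-- [folklore] The commutator of a LOCALISED kernel with a bounded-localised `f̂` is localised (FILE B's envelope shape): `Loc (x z ↦ (f z − f x)·V x z)`. -/
theorem loc_commK {f : Site 4 → ℝ} {p : Site 4} {Cf δ : ℝ} (hδ : 0 < δ) (hf : ∀ x, |f x| ≤ Cf * Real.exp (-δ * l1 (x - p)))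
    {V : MKer 4 Unit} (hV : Loc V) : Loc (fun x z (_ _ : Unit) => (f z - f x) * V x z () ()) := by
  have hC := env_const_nonneg hf
  have hfb := abs_le_env_const hδ hf
  obtain ⟨p', q', C, δ', hδ', hVb⟩ := hV
  refine ⟨p', q', 2 * Cf * C, δ', hδ', fun x z u v => ?_⟩
  obtain rfl : u = () := Subsingleton.elim _ _
  obtain rfl : v = () := Subsingleton.elim _ _
  have hC0 : 0 ≤ C := hVb.nonneg ()
  show |(f z - f x) * V x z () ()| ≤ _
  rw [abs_mul]
  calc |f z - f x| * |V x z () ()| ≤ (Cf + Cf) * (C * Real.exp (-δ' * (l1 (x - p') + l1 (z - q')))) :=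
        mul_le_mul ((abs_sub _ _).trans (add_le_add (hfb z) (hfb x))) (hVb x z () ()) (abs_nonneg _) (by positivity)
    _ = _ := by ring

/-! ## §2 The instance: the road's dressed and undressed weights, the block gauge function, the two identities -/

section Road

variable (m : ℕ) {a : ℝ} {r : Fin (3 + 1) → ℕ} (hr : r ∈ box (3 + 1) (m + 1))

/-- [folklore] The fine rate `κ₁∕(4n)` is positive. -/
theorem rate_pos : 0 < kappa163 (3 + 1) / (3 + 1) / (4 * ((m + 1 : ℕ) : ℝ)) := by
  have h1 := kappa163_pos (3 + 1)
  have h2 : (0 : ℝ) < ((m + 1 : ℕ) : ℝ) := by exact_mod_cast Nat.succ_pos m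
  positivity

include hr

/-- [folklore] **THE UNDRESSED WEIGHT FAMILY IS THE DRESSED ONE PLUS THE GRADIENT OF THE BLOCK GAUGE FUNCTION** (gan24-leaf-05's
`colH_coDressKBmAt_eq_sub_grad`, rearranged; as an equality of fine-bond families `κ u ↦ …`). -/
theorem colH_K₀_eq_G₀_add_grad (μ : Fin 4) (y : Site 4) :
    colH (KInvStep (d := 3) (m + 1) 0) (m + 1) μ y
      = fun κ u => colH (coDressKBmAt (toSite r) (m + 1) (KInvStep (d := 3) (m + 1) 0)) (m + 1) μ y κ u
          + (bmGaugeAt (toSite r) (colH (KInvStep (d := 3) (m + 1) 0) (m + 1) μ y) (m + 1) (u + unitVec κ)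
              - bmGaugeAt (toSite r) (colH (KInvStep (d := 3) (m + 1) 0) (m + 1) μ y) (m + 1) u) := by
  funext κ u
  have h := colH_coDressKBmAt_eq_sub_grad (d := 3) (Nat.le_add_left 1 m) hr (KInvStep (d := 3) (m + 1) 0) μ y κ u
  linarith

/-- [folklore] The block gauge function of the undressed column is bounded: `|χ_{μ,y}(x)| ≤ 8·(M·P·e^{κ₁})·e^{2κ₁}·n⁻⁴` (FILE A's envelope, `e^{−…} ≤ 1`). -/
theorem abs_bmGauge_colH_K₀_bdd (μ : Fin 4) (y x : Site 4) :
    |bmGaugeAt (toSite r) (colH (KInvStep (d := 3) (m + 1) 0) (m + 1) μ y) (m + 1) x|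
      ≤ 8 * ((MG163 (3 + 1) * periodConst (kappa163 (3 + 1)) 3) * Real.exp (kappa163 (3 + 1) / (3 + 1))) * Real.exp (2 * (kappa163 (3 + 1) / (3 + 1)))
          * ((((m + 1 : ℕ) : ℝ)) ^ 4)⁻¹ :=
  abs_le_env_const (rate_pos m) (abs_bmGauge_colH_K₀_le' m hr μ y) x

/-- [folklore] **THE UNDRESSED `D*D` JET IS THE DRESSED ONE PLUS `[n²(−Δ), χ̂_{μ,y}]`.** -/
theorem packD_stencil_K₀_eq (μ : Fin 4) (y : Site 4) :
    (∑ κ : Fin 4, wsum (colH (KInvStep (d := 3) (m + 1) 0) (m + 1) μ y κ) (fun u => (((m + 1 : ℕ) : ℝ) ^ 2) • ghCur κ u))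
      = (∑ κ : Fin 4, wsum (colH (coDressKBmAt (toSite r) (m + 1) (KInvStep (d := 3) (m + 1) 0)) (m + 1) μ y κ)
            (fun u => (((m + 1 : ℕ) : ℝ) ^ 2) • ghCur κ u))
        + (fun x z (_ _ : Unit) => (bmGaugeAt (toSite r) (colH (KInvStep (d := 3) (m + 1) 0) (m + 1) μ y) (m + 1) z
              - bmGaugeAt (toSite r) (colH (KInvStep (d := 3) (m + 1) 0) (m + 1) μ y) (m + 1) x)
            * ((((m + 1 : ℕ) : ℝ) ^ 2) * lapKer (d := 4) x z)) := by
  conv_lhs => rw [colH_K₀_eq_G₀_add_grad m hr μ y]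
  rw [packD_stencil_add (((m + 1 : ℕ) : ℝ) ^ 2) (fun κ => colH (coDressKBmAt (toSite r) (m + 1) (KInvStep (d := 3) (m + 1) 0)) (m + 1) μ y κ)
    (fun κ u => bmGaugeAt (toSite r) (colH (KInvStep (d := 3) (m + 1) 0) (m + 1) μ y) (m + 1) (u + unitVec κ)
      - bmGaugeAt (toSite r) (colH (KInvStep (d := 3) (m + 1) 0) (m + 1) μ y) (m + 1) u),
    packD_stencil_grad (((m + 1 : ℕ) : ℝ) ^ 2) (abs_bmGauge_colH_K₀_bdd m hr μ y)]

/-- [folklore] **THE UNDRESSED `D*D` TABLE IS THE DRESSED ONE PLUS THE TWO COMMUTED JETS**: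
`𝒲_D[K₀,K₀](μ,y;ν,y′) = 𝒲_D[G₀,G₀](μ,y;ν,y′) + [𝒱_D[G₀]_{μ,y}, χ̂_{ν,y′}] + [𝒱_D[K₀]_{ν,y′}, χ̂_{μ,y}]`. -/
theorem packD_table_K₀_eq (μ : Fin 4) (y : Site 4) (ν : Fin 4) (y' : Site 4) :
    (∑ κ : Fin 4, ∑ l : Fin 4, wsum (colH (KInvStep (d := 3) (m + 1) 0) (m + 1) μ y κ)
        (fun u => wsum (colH (KInvStep (d := 3) (m + 1) 0) (m + 1) ν y' l) (diagExt (fun μ y => ((-1) * ((m + 1 : ℕ) : ℝ) ^ 2) • ghX μ y) κ u l)))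
      = (∑ κ : Fin 4, ∑ l : Fin 4, wsum (colH (coDressKBmAt (toSite r) (m + 1) (KInvStep (d := 3) (m + 1) 0)) (m + 1) μ y κ)
          (fun u => wsum (colH (coDressKBmAt (toSite r) (m + 1) (KInvStep (d := 3) (m + 1) 0)) (m + 1) ν y' l)
            (diagExt (fun μ y => ((-1) * ((m + 1 : ℕ) : ℝ) ^ 2) • ghX μ y) κ u l)))
        + (fun x z (_ _ : Unit) => (bmGaugeAt (toSite r) (colH (KInvStep (d := 3) (m + 1) 0) (m + 1) ν y') (m + 1) z
              - bmGaugeAt (toSite r) (colH (KInvStep (d := 3) (m + 1) 0) (m + 1) ν y') (m + 1) x)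
            * (∑ κ : Fin 4, wsum (colH (coDressKBmAt (toSite r) (m + 1) (KInvStep (d := 3) (m + 1) 0)) (m + 1) μ y κ)
                (fun u => (((m + 1 : ℕ) : ℝ) ^ 2) • ghCur κ u)) x z () ())
        + (fun x z (_ _ : Unit) => (bmGaugeAt (toSite r) (colH (KInvStep (d := 3) (m + 1) 0) (m + 1) μ y) (m + 1) z
              - bmGaugeAt (toSite r) (colH (KInvStep (d := 3) (m + 1) 0) (m + 1) μ y) (m + 1) x)
            * (∑ κ : Fin 4, wsum (colH (KInvStep (d := 3) (m + 1) 0) (m + 1) ν y' κ)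
                (fun u => (((m + 1 : ℕ) : ℝ) ^ 2) • ghCur κ u)) x z () ()) := by
  have h1 := packD_table_add_left (((m + 1 : ℕ) : ℝ) ^ 2)
    (fun κ => colH (coDressKBmAt (toSite r) (m + 1) (KInvStep (d := 3) (m + 1) 0)) (m + 1) μ y κ)
    (fun κ u => bmGaugeAt (toSite r) (colH (KInvStep (d := 3) (m + 1) 0) (m + 1) μ y) (m + 1) (u + unitVec κ)
      - bmGaugeAt (toSite r) (colH (KInvStep (d := 3) (m + 1) 0) (m + 1) μ y) (m + 1) u)
    (fun l => colH (KInvStep (d := 3) (m + 1) 0) (m + 1) ν y' l)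
  have h2 := packD_table_add_right (((m + 1 : ℕ) : ℝ) ^ 2)
    (fun κ => colH (coDressKBmAt (toSite r) (m + 1) (KInvStep (d := 3) (m + 1) 0)) (m + 1) μ y κ)
    (fun l => colH (coDressKBmAt (toSite r) (m + 1) (KInvStep (d := 3) (m + 1) 0)) (m + 1) ν y' l)
    (fun l u => bmGaugeAt (toSite r) (colH (KInvStep (d := 3) (m + 1) 0) (m + 1) ν y') (m + 1) (u + unitVec l)
      - bmGaugeAt (toSite r) (colH (KInvStep (d := 3) (m + 1) 0) (m + 1) ν y') (m + 1) u)
  have h3 := packD_table_grad_right (((m + 1 : ℕ) : ℝ) ^ 2)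
    (fun κ => colH (coDressKBmAt (toSite r) (m + 1) (KInvStep (d := 3) (m + 1) 0)) (m + 1) μ y κ)
    (bmGaugeAt (toSite r) (colH (KInvStep (d := 3) (m + 1) 0) (m + 1) ν y') (m + 1))
  have h4 := packD_table_grad_left (((m + 1 : ℕ) : ℝ) ^ 2)
    (fun l => colH (KInvStep (d := 3) (m + 1) 0) (m + 1) ν y' l)
    (bmGaugeAt (toSite r) (colH (KInvStep (d := 3) (m + 1) 0) (m + 1) μ y) (m + 1))
  -- split the second weight of the dressed-first summand BEFORE the first slot is rewritten (the last summand keeps its `K₀` vertex)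
  have h2' : (∑ κ : Fin 4, ∑ l : Fin 4, wsum (colH (coDressKBmAt (toSite r) (m + 1) (KInvStep (d := 3) (m + 1) 0)) (m + 1) μ y κ)
        (fun u => wsum (colH (KInvStep (d := 3) (m + 1) 0) (m + 1) ν y' l) (diagExt (fun μ y => ((-1) * ((m + 1 : ℕ) : ℝ) ^ 2) • ghX μ y) κ u l)))
      = (∑ κ : Fin 4, ∑ l : Fin 4, wsum (colH (coDressKBmAt (toSite r) (m + 1) (KInvStep (d := 3) (m + 1) 0)) (m + 1) μ y κ)
          (fun u => wsum (colH (coDressKBmAt (toSite r) (m + 1) (KInvStep (d := 3) (m + 1) 0)) (m + 1) ν y' l)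
            (diagExt (fun μ y => ((-1) * ((m + 1 : ℕ) : ℝ) ^ 2) • ghX μ y) κ u l)))
        + (fun x z (_ _ : Unit) => (bmGaugeAt (toSite r) (colH (KInvStep (d := 3) (m + 1) 0) (m + 1) ν y') (m + 1) z
              - bmGaugeAt (toSite r) (colH (KInvStep (d := 3) (m + 1) 0) (m + 1) ν y') (m + 1) x)
            * (∑ κ : Fin 4, wsum (colH (coDressKBmAt (toSite r) (m + 1) (KInvStep (d := 3) (m + 1) 0)) (m + 1) μ y κ)
                (fun u => (((m + 1 : ℕ) : ℝ) ^ 2) • ghCur κ u)) x z () ()) := by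
    conv_lhs => rw [colH_K₀_eq_G₀_add_grad m hr ν y']
    rw [h2, h3]
  conv_lhs => rw [colH_K₀_eq_G₀_add_grad m hr μ y]
  rw [h1, h2', h4]

variable (ha : 0 < a)
include ha

/-- [folklore] **THE GAUGE VARIATION OF THE `D*D`-ONLY GHOST WORD — TWO-TERM (MIXED) FORM**:
`DD[colH K₀] μ ν z − DD[colH G₀] μ ν z = ½·bubble Ggh [P_a, χ̂_{μ,0}] 𝒱_D[colH K₀]_{ν,z} + ½·bubble Ggh 𝒱_D[colH G₀]_{μ,0} [P_a, χ̂_{ν,z}]`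
(§1 + an2's `tadpole_add ∕ bubble_add_left ∕ bubble_add_right` + FILE B's `hess_grad_slot ∕ hess_slot_grad`). -/
theorem DD_K₀_sub_DD_G₀_eq_two (μ ν : Fin 4) (z : Site 4) :
    hessKer (Ggh (m + 1) a)
        (fun μ y => ∑ κ : Fin 4, wsum (colH (KInvStep (d := 3) (m + 1) 0) (m + 1) μ y κ) (fun u => (((m + 1 : ℕ) : ℝ) ^ 2) • ghCur κ u))
        (fun μ y ν y' => ∑ κ : Fin 4, ∑ l : Fin 4, wsum (colH (KInvStep (d := 3) (m + 1) 0) (m + 1) μ y κ)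
          (fun u => wsum (colH (KInvStep (d := 3) (m + 1) 0) (m + 1) ν y' l) (diagExt (fun μ y => ((-1) * ((m + 1 : ℕ) : ℝ) ^ 2) • ghX μ y) κ u l))) μ ν z
      - hessKer (Ggh (m + 1) a)
        (fun μ y => ∑ κ : Fin 4, wsum (colH (coDressKBmAt (toSite r) (m + 1) (KInvStep (d := 3) (m + 1) 0)) (m + 1) μ y κ)
          (fun u => (((m + 1 : ℕ) : ℝ) ^ 2) • ghCur κ u))
        (fun μ y ν y' => ∑ κ : Fin 4, ∑ l : Fin 4, wsum (colH (coDressKBmAt (toSite r) (m + 1) (KInvStep (d := 3) (m + 1) 0)) (m + 1) μ y κ)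
          (fun u => wsum (colH (coDressKBmAt (toSite r) (m + 1) (KInvStep (d := 3) (m + 1) 0)) (m + 1) ν y' l)
            (diagExt (fun μ y => ((-1) * ((m + 1 : ℕ) : ℝ) ^ 2) • ghX μ y) κ u l))) μ ν z
      = (1 / 2) * bubble (Ggh (m + 1) a)
          (fun x z' (_ _ : Unit) => (bmGaugeAt (toSite r) (colH (KInvStep (d := 3) (m + 1) 0) (m + 1) μ 0) (m + 1) z'
              - bmGaugeAt (toSite r) (colH (KInvStep (d := 3) (m + 1) 0) (m + 1) μ 0) (m + 1) x)
            * (a / (((m + 1 : ℕ) : ℝ)) ^ 4 * sameBlk (m + 1 - 1) x z'))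
          (∑ κ : Fin 4, wsum (colH (KInvStep (d := 3) (m + 1) 0) (m + 1) ν z κ) (fun u => (((m + 1 : ℕ) : ℝ) ^ 2) • ghCur κ u))
        + (1 / 2) * bubble (Ggh (m + 1) a)
          (∑ κ : Fin 4, wsum (colH (coDressKBmAt (toSite r) (m + 1) (KInvStep (d := 3) (m + 1) 0)) (m + 1) μ 0 κ)
            (fun u => (((m + 1 : ℕ) : ℝ) ^ 2) • ghCur κ u))
          (fun x z' (_ _ : Unit) => (bmGaugeAt (toSite r) (colH (KInvStep (d := 3) (m + 1) 0) (m + 1) ν z) (m + 1) z'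
              - bmGaugeAt (toSite r) (colH (KInvStep (d := 3) (m + 1) 0) (m + 1) ν z) (m + 1) x)
            * (a / (((m + 1 : ℕ) : ℝ)) ^ 4 * sameBlk (m + 1 - 1) x z')) := by
  -- letters
  have hG : Spr (Ggh (m + 1) a) := spr_Ggh (m + 1) a ha
  have hn : (0 : ℝ) < ((m + 1 : ℕ) : ℝ) := by exact_mod_cast Nat.succ_pos m
  have hrate := rate_pos m
  have hχ := fun μ' y' => abs_bmGauge_colH_K₀_le' m hr μ' y'
  have hS : ∀ (κ : Fin 4) (u : Site 4), BiLoc ((fun κ u => (((m + 1 : ℕ) : ℝ) ^ 2) • ghCur κ u) κ u) u u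
      (|((m + 1 : ℕ) : ℝ) ^ 2| * Real.exp 1) 1 := fun κ u => biLoc_smul' _ (biLoc_ghCur κ u 1)
  have hT : ∀ μ' y', BiLoc ((fun μ y => ((-1) * ((m + 1 : ℕ) : ℝ) ^ 2) • ghX μ y) μ' y') y' y' (|(-1) * ((m + 1 : ℕ) : ℝ) ^ 2| * Real.exp 1) 1 :=
    fun μ' y' => biLoc_smul' _ (biLoc_ghX μ' y' 1)
  have hW : ∀ (κ : Fin 4) (u : Site 4) (l : Fin 4) (u' : Site 4),
      BiLoc (diagExt (fun μ y => ((-1) * ((m + 1 : ℕ) : ℝ) ^ 2) • ghX μ y) κ u l u') u u' (|(-1) * ((m + 1 : ℕ) : ℝ) ^ 2| * Real.exp 1) 1 :=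
    fun κ u l u' => biLoc_diagExt _ hT (by positivity) κ u l u'
  have hwK := fun μ y κ u => abs_colH_K₀_road_le_l1 m μ y κ u
  have hwG := fun μ y κ u => abs_colH_G₀_road_le m hr μ y κ u
  -- Loc of the packed pieces
  have LVK : ∀ (μ : Fin 4) (y : Site 4), Loc (∑ κ : Fin 4, wsum (colH (KInvStep (d := 3) (m + 1) 0) (m + 1) μ y κ)
      (fun u => (((m + 1 : ℕ) : ℝ) ^ 2) • ghCur κ u)) := fun μ y =>
    loc_finset_sum _ fun κ => loc_packed_stencil hS one_pos hwK (colH_K₀_road_weight_nonneg m) (road_rate_pos m) μ y κ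
  have LVG : ∀ (μ : Fin 4) (y : Site 4), Loc (∑ κ : Fin 4, wsum (colH (coDressKBmAt (toSite r) (m + 1) (KInvStep (d := 3) (m + 1) 0)) (m + 1) μ y κ)
      (fun u => (((m + 1 : ℕ) : ℝ) ^ 2) • ghCur κ u)) := fun μ y =>
    loc_finset_sum _ fun κ => loc_packed_stencil hS one_pos hwG (colH_G₀_road_weight_nonneg m) (road_rate_pos m) μ y κ
  have LWG : Loc (∑ κ : Fin 4, ∑ l : Fin 4, wsum (colH (coDressKBmAt (toSite r) (m + 1) (KInvStep (d := 3) (m + 1) 0)) (m + 1) μ 0 κ)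
      (fun u => wsum (colH (coDressKBmAt (toSite r) (m + 1) (KInvStep (d := 3) (m + 1) 0)) (m + 1) ν z l)
        (diagExt (fun μ y => ((-1) * ((m + 1 : ℕ) : ℝ) ^ 2) • ghX μ y) κ u l))) :=
    loc_finset_sum _ fun κ => loc_finset_sum _ fun l => loc_packed_table hW one_pos hwG (colH_G₀_road_weight_nonneg m) (road_rate_pos m) μ 0 ν z κ l
  have LΓ := fun μ' y' => loc_commK_lap (n := m + 1) (hrate) (hχ μ' y')
  have LB := fun μ' y' => loc_commK_blk (n := m + 1) (a := a) hrate (hχ μ' y')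
  -- the two Ward slots (FILE B)
  have h5 := hess_grad_slot (m + 1) a ha hrate (hχ μ 0) (LVK ν z)
  have h6 := hess_slot_grad (m + 1) a ha hrate (hχ ν z) (LVG μ 0)
  -- expand
  simp only [ExpKernelCalculus.hessKer]
  rw [packD_table_K₀_eq m hr μ 0 ν z, tadpole_add hG (LWG.add (loc_commK hrate (hχ ν z) (LVG μ 0))) (loc_commK hrate (hχ μ 0) (LVK ν z)),
    tadpole_add hG LWG (loc_commK hrate (hχ ν z) (LVG μ 0))]
  rw [packD_stencil_K₀_eq m hr μ 0, bubble_add_left hG (LVG μ 0) (LΓ μ 0) (LVK ν z)]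
  rw [show bubble (Ggh (m + 1) a)
        (∑ κ : Fin 4, wsum (colH (coDressKBmAt (toSite r) (m + 1) (KInvStep (d := 3) (m + 1) 0)) (m + 1) μ 0 κ)
          (fun u => (((m + 1 : ℕ) : ℝ) ^ 2) • ghCur κ u))
        (∑ κ : Fin 4, wsum (colH (KInvStep (d := 3) (m + 1) 0) (m + 1) ν z κ) (fun u => (((m + 1 : ℕ) : ℝ) ^ 2) • ghCur κ u))
      = bubble (Ggh (m + 1) a)
        (∑ κ : Fin 4, wsum (colH (coDressKBmAt (toSite r) (m + 1) (KInvStep (d := 3) (m + 1) 0)) (m + 1) μ 0 κ)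
          (fun u => (((m + 1 : ℕ) : ℝ) ^ 2) • ghCur κ u))
        (∑ κ : Fin 4, wsum (colH (coDressKBmAt (toSite r) (m + 1) (KInvStep (d := 3) (m + 1) 0)) (m + 1) ν z κ)
          (fun u => (((m + 1 : ℕ) : ℝ) ^ 2) • ghCur κ u))
        + bubble (Ggh (m + 1) a)
        (∑ κ : Fin 4, wsum (colH (coDressKBmAt (toSite r) (m + 1) (KInvStep (d := 3) (m + 1) 0)) (m + 1) μ 0 κ)
          (fun u => (((m + 1 : ℕ) : ℝ) ^ 2) • ghCur κ u))
        (fun x z' (_ _ : Unit) => (bmGaugeAt (toSite r) (colH (KInvStep (d := 3) (m + 1) 0) (m + 1) ν z) (m + 1) z'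
              - bmGaugeAt (toSite r) (colH (KInvStep (d := 3) (m + 1) 0) (m + 1) ν z) (m + 1) x)
            * ((((m + 1 : ℕ) : ℝ) ^ 2) * lapKer (d := 4) x z'))
      from by rw [packD_stencil_K₀_eq m hr ν z, bubble_add_right hG (LVG μ 0) (LVG ν z) (LΓ ν z)]]
  linarith [h5, h6]

/-- [folklore] **THE GAUGE VARIATION — FOUR-TERM FORM, ALL VERTICES AT THE UNDRESSED WEIGHTS**: the dressed vertex of the two-term form is
`𝒱_D[K₀] − [n²(−Δ), χ̂]`, `[n²(−Δ), χ̂] = [O, χ̂] − [P_a, χ̂]`, and the `[O, χ̂]` bubble telescopes by Ω to a double-commutator tadpole: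
`DD[K₀] − DD[G₀] = ½·bubble Ggh [P_a, χ̂_{μ,0}] 𝒱_D[K₀]_{ν,z} + ½·bubble Ggh 𝒱_D[K₀]_{μ,0} [P_a, χ̂_{ν,z}] − ½·tadpole Ggh [[P_a, χ̂_{ν,z}], χ̂_{μ,0}]
+ ½·bubble Ggh [P_a, χ̂_{μ,0}] [P_a, χ̂_{ν,z}]` — every word carries a frozen-averaging factor `P_a = a·n⁻⁴·1[same block]`. -/
theorem DD_K₀_sub_DD_G₀_eq_four (μ ν : Fin 4) (z : Site 4) :
    hessKer (Ggh (m + 1) a)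
        (fun μ y => ∑ κ : Fin 4, wsum (colH (KInvStep (d := 3) (m + 1) 0) (m + 1) μ y κ) (fun u => (((m + 1 : ℕ) : ℝ) ^ 2) • ghCur κ u))
        (fun μ y ν y' => ∑ κ : Fin 4, ∑ l : Fin 4, wsum (colH (KInvStep (d := 3) (m + 1) 0) (m + 1) μ y κ)
          (fun u => wsum (colH (KInvStep (d := 3) (m + 1) 0) (m + 1) ν y' l) (diagExt (fun μ y => ((-1) * ((m + 1 : ℕ) : ℝ) ^ 2) • ghX μ y) κ u l))) μ ν z
      - hessKer (Ggh (m + 1) a)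
        (fun μ y => ∑ κ : Fin 4, wsum (colH (coDressKBmAt (toSite r) (m + 1) (KInvStep (d := 3) (m + 1) 0)) (m + 1) μ y κ)
          (fun u => (((m + 1 : ℕ) : ℝ) ^ 2) • ghCur κ u))
        (fun μ y ν y' => ∑ κ : Fin 4, ∑ l : Fin 4, wsum (colH (coDressKBmAt (toSite r) (m + 1) (KInvStep (d := 3) (m + 1) 0)) (m + 1) μ y κ)
          (fun u => wsum (colH (coDressKBmAt (toSite r) (m + 1) (KInvStep (d := 3) (m + 1) 0)) (m + 1) ν y' l)
            (diagExt (fun μ y => ((-1) * ((m + 1 : ℕ) : ℝ) ^ 2) • ghX μ y) κ u l))) μ ν z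
      = (1 / 2) * bubble (Ggh (m + 1) a)
          (fun x z' (_ _ : Unit) => (bmGaugeAt (toSite r) (colH (KInvStep (d := 3) (m + 1) 0) (m + 1) μ 0) (m + 1) z'
              - bmGaugeAt (toSite r) (colH (KInvStep (d := 3) (m + 1) 0) (m + 1) μ 0) (m + 1) x)
            * (a / (((m + 1 : ℕ) : ℝ)) ^ 4 * sameBlk (m + 1 - 1) x z'))
          (∑ κ : Fin 4, wsum (colH (KInvStep (d := 3) (m + 1) 0) (m + 1) ν z κ) (fun u => (((m + 1 : ℕ) : ℝ) ^ 2) • ghCur κ u))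
        + (1 / 2) * bubble (Ggh (m + 1) a)
          (∑ κ : Fin 4, wsum (colH (KInvStep (d := 3) (m + 1) 0) (m + 1) μ 0 κ) (fun u => (((m + 1 : ℕ) : ℝ) ^ 2) • ghCur κ u))
          (fun x z' (_ _ : Unit) => (bmGaugeAt (toSite r) (colH (KInvStep (d := 3) (m + 1) 0) (m + 1) ν z) (m + 1) z'
              - bmGaugeAt (toSite r) (colH (KInvStep (d := 3) (m + 1) 0) (m + 1) ν z) (m + 1) x)
            * (a / (((m + 1 : ℕ) : ℝ)) ^ 4 * sameBlk (m + 1 - 1) x z'))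
        - (1 / 2) * tadpole (Ggh (m + 1) a)
          (fun x z' (_ _ : Unit) => (bmGaugeAt (toSite r) (colH (KInvStep (d := 3) (m + 1) 0) (m + 1) μ 0) (m + 1) z'
              - bmGaugeAt (toSite r) (colH (KInvStep (d := 3) (m + 1) 0) (m + 1) μ 0) (m + 1) x)
            * ((bmGaugeAt (toSite r) (colH (KInvStep (d := 3) (m + 1) 0) (m + 1) ν z) (m + 1) z'
                - bmGaugeAt (toSite r) (colH (KInvStep (d := 3) (m + 1) 0) (m + 1) ν z) (m + 1) x)
              * (a / (((m + 1 : ℕ) : ℝ)) ^ 4 * sameBlk (m + 1 - 1) x z')))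
        + (1 / 2) * bubble (Ggh (m + 1) a)
          (fun x z' (_ _ : Unit) => (bmGaugeAt (toSite r) (colH (KInvStep (d := 3) (m + 1) 0) (m + 1) μ 0) (m + 1) z'
              - bmGaugeAt (toSite r) (colH (KInvStep (d := 3) (m + 1) 0) (m + 1) μ 0) (m + 1) x)
            * (a / (((m + 1 : ℕ) : ℝ)) ^ 4 * sameBlk (m + 1 - 1) x z'))
          (fun x z' (_ _ : Unit) => (bmGaugeAt (toSite r) (colH (KInvStep (d := 3) (m + 1) 0) (m + 1) ν z) (m + 1) z'
              - bmGaugeAt (toSite r) (colH (KInvStep (d := 3) (m + 1) 0) (m + 1) ν z) (m + 1) x)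
            * (a / (((m + 1 : ℕ) : ℝ)) ^ 4 * sameBlk (m + 1 - 1) x z')) := by
  have hG : Spr (Ggh (m + 1) a) := spr_Ggh (m + 1) a ha
  have hrate := rate_pos m
  have hχ := fun μ' y' => abs_bmGauge_colH_K₀_le' m hr μ' y'
  have hS : ∀ (κ : Fin 4) (u : Site 4), BiLoc ((fun κ u => (((m + 1 : ℕ) : ℝ) ^ 2) • ghCur κ u) κ u) u u
      (|((m + 1 : ℕ) : ℝ) ^ 2| * Real.exp 1) 1 := fun κ u => biLoc_smul' _ (biLoc_ghCur κ u 1)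
  have LVK : ∀ (μ : Fin 4) (y : Site 4), Loc (∑ κ : Fin 4, wsum (colH (KInvStep (d := 3) (m + 1) 0) (m + 1) μ y κ)
      (fun u => (((m + 1 : ℕ) : ℝ) ^ 2) • ghCur κ u)) := fun μ y =>
    loc_finset_sum _ fun κ => loc_packed_stencil hS one_pos (fun μ y κ u => abs_colH_K₀_road_le_l1 m μ y κ u)
      (colH_K₀_road_weight_nonneg m) (road_rate_pos m) μ y κ
  have LΓ := fun μ' y' => loc_commK_lap (n := m + 1) hrate (hχ μ' y')
  have LO := fun μ' y' => loc_commK_Oker (n := m + 1) (a := a) hrate (hχ μ' y')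
  have LB := fun μ' y' => loc_commK_blk (n := m + 1) (a := a) hrate (hχ μ' y')
  rw [DD_K₀_sub_DD_G₀_eq_two m hr ha μ ν z]
  -- the dressed vertex as `𝒱_D[K₀] − [n²(−Δ), χ̂_{μ,0}]`
  have eV := packD_stencil_K₀_eq m hr μ 0
  rw [eq_sub_of_add_eq eV.symm, bubble_sub_left hG (LVK μ 0) (LΓ μ 0) (LB ν z)]
  -- `[n²(−Δ), χ̂] = [O, χ̂] − [P_a, χ̂]`, split, symmetrise, telescope by Ω
  have hsplit : (fun x z' (_ _ : Unit) => (bmGaugeAt (toSite r) (colH (KInvStep (d := 3) (m + 1) 0) (m + 1) μ 0) (m + 1) z'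
        - bmGaugeAt (toSite r) (colH (KInvStep (d := 3) (m + 1) 0) (m + 1) μ 0) (m + 1) x) * ((((m + 1 : ℕ) : ℝ) ^ 2) * lapKer (d := 4) x z'))
      = (fun x z' (_ _ : Unit) => (bmGaugeAt (toSite r) (colH (KInvStep (d := 3) (m + 1) 0) (m + 1) μ 0) (m + 1) z'
          - bmGaugeAt (toSite r) (colH (KInvStep (d := 3) (m + 1) 0) (m + 1) μ 0) (m + 1) x) * Oker (m + 1) a x z' () ())
        - (fun x z' (_ _ : Unit) => (bmGaugeAt (toSite r) (colH (KInvStep (d := 3) (m + 1) 0) (m + 1) μ 0) (m + 1) z'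
          - bmGaugeAt (toSite r) (colH (KInvStep (d := 3) (m + 1) 0) (m + 1) μ 0) (m + 1) x) * (a / (((m + 1 : ℕ) : ℝ)) ^ 4 * sameBlk (m + 1 - 1) x z')) := by
    funext x z' u v
    simp only [Pi.sub_apply, Oker_apply]
    ring
  rw [hsplit, bubble_sub_left hG (LO μ 0) (LB μ 0) (LB ν z), bubble_symm hG (LO μ 0) (LB ν z),
    bubble_Ggh_comm_Oker (m + 1) a ha hrate (hχ μ 0) (LB ν z)]
  ring

/-! ## §3 The headline: the four `Q′`-words at the road's dressed weights, in closed form -/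

/-- [folklore] **THE FOUR `Q′`-WORDS AT THE ROAD's DRESSED WEIGHTS, IN CLOSED FORM** (FILE C3 + the four-term gauge variation):
`BR[colH G₀] μ ν z = (PghQ n a (−1) n² a − PghQ n a (−1) n² 0) μ ν z` (`= −½·ΔGH`, g18's (1.22)-vanishing row) `+ ½·bubble Ggh [P_a, χ̂_{μ,0}] 𝒱_D[K₀]_{ν,z}
+ ½·bubble Ggh 𝒱_D[K₀]_{μ,0} [P_a, χ̂_{ν,z}] − ½·tadpole Ggh [[P_a, χ̂_{ν,z}], χ̂_{μ,0}] + ½·bubble Ggh [P_a, χ̂_{μ,0}] [P_a, χ̂_{ν,z}]` — every correction carries the frozen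
averaging `P_a = a·n⁻⁴·1[same block]` and the LOCALISED block gauge function `χ` (FILE A: `n⁻⁴·e^{−(κ₁∕4n)|· − n•y|₁}`). -/
theorem BR_G₀_eq_deltaGH_add_four (μ ν : Fin 4) (z : Site 4) :
    ((1 / 2) * tadpole (Ggh (m + 1) a) (∑ κ : Fin 4, ∑ l : Fin 4,
          wsum (colH (coDressKBmAt (toSite r) (m + 1) (KInvStep (d := 3) (m + 1) 0)) (m + 1) μ 0 κ)
            (fun u => wsum (colH (coDressKBmAt (toSite r) (m + 1) (KInvStep (d := 3) (m + 1) 0)) (m + 1) ν z l)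
              (fun v' => (-((-1) * a * ((m + 1 : ℕ) : ℝ) ^ 4)) • qSqAt (ctrHalf (m + 1)) (m + 1) κ u l v')))
        - (1 / 2) * (bubble (Ggh (m + 1) a)
              (∑ κ : Fin 4, wsum (colH (coDressKBmAt (toSite r) (m + 1) (KInvStep (d := 3) (m + 1) 0)) (m + 1) μ 0 κ)
                (fun u => (((m + 1 : ℕ) : ℝ) ^ 2) • ghCur κ u))
              (∑ κ : Fin 4, wsum (colH (coDressKBmAt (toSite r) (m + 1) (KInvStep (d := 3) (m + 1) 0)) (m + 1) ν z κ)
                (fun u => a • qAntiAt (ctrHalf (m + 1)) (m + 1) κ u))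
            + bubble (Ggh (m + 1) a)
              (∑ κ : Fin 4, wsum (colH (coDressKBmAt (toSite r) (m + 1) (KInvStep (d := 3) (m + 1) 0)) (m + 1) μ 0 κ)
                (fun u => a • qAntiAt (ctrHalf (m + 1)) (m + 1) κ u))
              (∑ κ : Fin 4, wsum (colH (coDressKBmAt (toSite r) (m + 1) (KInvStep (d := 3) (m + 1) 0)) (m + 1) ν z κ)
                (fun u => (((m + 1 : ℕ) : ℝ) ^ 2) • ghCur κ u))
            + bubble (Ggh (m + 1) a)
              (∑ κ : Fin 4, wsum (colH (coDressKBmAt (toSite r) (m + 1) (KInvStep (d := 3) (m + 1) 0)) (m + 1) μ 0 κ)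
                (fun u => a • qAntiAt (ctrHalf (m + 1)) (m + 1) κ u))
              (∑ κ : Fin 4, wsum (colH (coDressKBmAt (toSite r) (m + 1) (KInvStep (d := 3) (m + 1) 0)) (m + 1) ν z κ)
                (fun u => a • qAntiAt (ctrHalf (m + 1)) (m + 1) κ u))))
      = (PghQ (m + 1) a (-1) (((m + 1 : ℕ) : ℝ) ^ 2) a μ ν z - PghQ (m + 1) a (-1) (((m + 1 : ℕ) : ℝ) ^ 2) 0 μ ν z)
        + ((1 / 2) * bubble (Ggh (m + 1) a)
            (fun x z' (_ _ : Unit) => (bmGaugeAt (toSite r) (colH (KInvStep (d := 3) (m + 1) 0) (m + 1) μ 0) (m + 1) z'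
                - bmGaugeAt (toSite r) (colH (KInvStep (d := 3) (m + 1) 0) (m + 1) μ 0) (m + 1) x)
              * (a / (((m + 1 : ℕ) : ℝ)) ^ 4 * sameBlk (m + 1 - 1) x z'))
            (∑ κ : Fin 4, wsum (colH (KInvStep (d := 3) (m + 1) 0) (m + 1) ν z κ) (fun u => (((m + 1 : ℕ) : ℝ) ^ 2) • ghCur κ u))
          + (1 / 2) * bubble (Ggh (m + 1) a)
            (∑ κ : Fin 4, wsum (colH (KInvStep (d := 3) (m + 1) 0) (m + 1) μ 0 κ) (fun u => (((m + 1 : ℕ) : ℝ) ^ 2) • ghCur κ u))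
            (fun x z' (_ _ : Unit) => (bmGaugeAt (toSite r) (colH (KInvStep (d := 3) (m + 1) 0) (m + 1) ν z) (m + 1) z'
                - bmGaugeAt (toSite r) (colH (KInvStep (d := 3) (m + 1) 0) (m + 1) ν z) (m + 1) x)
              * (a / (((m + 1 : ℕ) : ℝ)) ^ 4 * sameBlk (m + 1 - 1) x z'))
          - (1 / 2) * tadpole (Ggh (m + 1) a)
            (fun x z' (_ _ : Unit) => (bmGaugeAt (toSite r) (colH (KInvStep (d := 3) (m + 1) 0) (m + 1) μ 0) (m + 1) z'
                - bmGaugeAt (toSite r) (colH (KInvStep (d := 3) (m + 1) 0) (m + 1) μ 0) (m + 1) x)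
              * ((bmGaugeAt (toSite r) (colH (KInvStep (d := 3) (m + 1) 0) (m + 1) ν z) (m + 1) z'
                  - bmGaugeAt (toSite r) (colH (KInvStep (d := 3) (m + 1) 0) (m + 1) ν z) (m + 1) x)
                * (a / (((m + 1 : ℕ) : ℝ)) ^ 4 * sameBlk (m + 1 - 1) x z')))
          + (1 / 2) * bubble (Ggh (m + 1) a)
            (fun x z' (_ _ : Unit) => (bmGaugeAt (toSite r) (colH (KInvStep (d := 3) (m + 1) 0) (m + 1) μ 0) (m + 1) z'
                - bmGaugeAt (toSite r) (colH (KInvStep (d := 3) (m + 1) 0) (m + 1) μ 0) (m + 1) x)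
              * (a / (((m + 1 : ℕ) : ℝ)) ^ 4 * sameBlk (m + 1 - 1) x z'))
            (fun x z' (_ _ : Unit) => (bmGaugeAt (toSite r) (colH (KInvStep (d := 3) (m + 1) 0) (m + 1) ν z) (m + 1) z'
                - bmGaugeAt (toSite r) (colH (KInvStep (d := 3) (m + 1) 0) (m + 1) ν z) (m + 1) x)
              * (a / (((m + 1 : ℕ) : ℝ)) ^ 4 * sameBlk (m + 1 - 1) x z'))) := by
  rw [BR_G₀_eq_BR_K₀_add m hr ha μ ν z, BR_K₀_eq_PghQ_sub m ha μ ν z, DD_K₀_sub_DD_G₀_eq_four m hr ha μ ν z]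

end Road

end Summit.QuantumFields.BalabanUV.Beta.D1BFx.GhostLoopGaugeVariation

end
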